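import Literature.NumberTheory.LFunctions.AFECoefficient
import HarnessLib

/-!
# Teukolsky–Press near-extremal incidence amplitudes: moduli and the dominance of the principal term

For a NEAR-EXTREMAL Kerr black hole (`σ = (r₊ − r₋)/r₊ ≪ 1`) and real frequencies near the superradiant
threshold, `ω̂ = 2M(ω − mΩ_H)/σ = O(1)`, Teukolsky–Press (1974) solved the radial Teukolsky equation by
matched asymptotic expansions: the ingoing solution is hypergeometric in the near zone,
`R^in = ₂F₁(α₊, α₋; 1 + s − 2iω̂; −x/σ)`, `α± = ½ + s ± iδ − im`, and its incident amplitude at infinity is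
the TWO-TERM expression (Gralla–Zimmerman–Zimmerman 2016, §2.2, eq. (Zin), transcribing TP74)

  `Z^in = (−im)^{−½−s+iδ−im} Γ(−2iδ)Γ(1−2iδ) / (Γ(α₋)Γ(½−s−iδ−im)) · Γ(1+s−2iω̂)/Γ(½−iδ+im−2iω̂) · σ^{α₊}
          + (δ → −δ)`,

`δ² = 7m²/4 − (s+½)² − ₛA_{ℓm}` (principal sectors: `δ² > 0`), with Wronskian `𝒲 = 2iωZ^in`. This file
records, for the scalar case `s = 0` and principal `δ > 0`, `m > 0`:

* `tpCoeff m δ ω̂` — the coefficient `C_δ` of `σ^{½+iδ}` (so `Z^in = C_δ σ^{½+iδ} + C_{−δ} σ^{½−iδ}`);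
* `normSq_tpCoeff` — its squared modulus in closed form (using the tree's
  `AFE.norm_Gamma_half_sub_sq`, `GammaVert.norm_sq_Gamma_one`),
  `‖C_δ‖² = e^{π(δ−m)} cosh²π(m+δ) cosh π(2ω̂−m+δ) ‖Γ(1−2iω̂)‖² / (π m sinh²(2πδ))`
  (`|Γ(½+iy)|² = π/cosh πy`, `|Γ(iy)|² = π/(y sinh πy)`, `|Γ(1+iy)|² = πy/sinh πy`,
  `|(−im)^w| = m^{Re w} e^{(π/2)·Im w}`);
* `norm_tpCoeff_neg_mul_cosh_le` — the ξ-UNIFORM comparison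
  `‖C_{−δ}‖·cosh π(m+δ) ≤ e^{0}… ` precisely `‖C_{−δ}‖² cosh²π(m+δ) ≤ ‖C_δ‖² cosh²π(m−δ)`, hence
  `norm_tpCoeff_neg_lt` : `‖C_{−δ}‖ < ‖C_δ‖` for all `ω̂` — the principal term `σ^{½+iδ}` ALWAYS dominates,
  by the factor `≥ cosh π(m+δ)/cosh π(m−δ) > e^{…}`; in particular the leading-order near-extremal Wronskian
  `|𝒲|² = 4ω²|Z^in|² = 4ω²σ|C_δ|²|1 + (C_{−δ}/C_δ)σ^{−2iδ}|²` never cancels: `|𝒲|² ≥ 4ω²σ‖C_δ‖²(1 − cosh π(m−δ)/cosh π(m+δ))²`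
  (`normSq_twoTerm_ge`), i.e. `|𝒲|⁻² ≲ σ⁻¹` with an explicit constant — the quantitative content behind
  "`|𝔚|² ≈ 490 κ₊` at the `(2,2)` threshold" (tree erratum on `Kerr.Costa2019_wronskianBound_subextremal`).

Pure special-function algebra (Mathlib `Complex.Gamma`, reflection formula via the tree's
`GammaVert.norm_sq_Gamma_half` / `norm_sq_Gamma_one`, `Complex.norm_cpow_of_ne_zero`); nothing about ODEs is
claimed here (the matching itself — that `Z^in` IS the incident amplitude up to `O(σ^γ)` — is TP74's
asymptotic statement, used by GZZ for quasinormal modes; it is not asserted in this file).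

References: S. A. Teukolsky, W. H. Press, ApJ 193 (1974) 443, §III and Appendix A [TeukolskyPress1974];
S. E. Gralla, A. Zimmerman, P. Zimmerman, PRD 94 (2016) 084017 = arXiv:1608.04739, §2.2 eqs. (5)–(9)
[GrallaZimmermanZimmerman2016]; DLMF 5.4.3–5.4.4 [DLMF].
-/

noncomputable section

open Complex Real

namespace Literature.Geometry.Lorentzian.Kerr.TeukolskyPress

/-- **The Teukolsky–Press coefficient `C_δ`** of `σ^{1/2 + iδ}` in the near-extremal incident amplitude
`Z^in` (scalar case `s = 0`): `C_δ(m, ω̂) = (−im)^{−½+iδ−im} · Γ(−2iδ)Γ(1−2iδ)/Γ(½−iδ−im)² ·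
Γ(1−2iω̂)/Γ(½−iδ+im−2iω̂)`; the second term of `Z^in` is `C_{−δ} σ^{1/2 − iδ}` = `tpCoeff m (-δ) ω̂`.
[cite: GrallaZimmermanZimmerman2016, Section 2.2 eq. (Zin)] -/
def tpCoeff (m δ ωh : ℝ) : ℂ :=
  (-(I * m)) ^ (-(1 / 2 : ℂ) + δ * I - m * I) *
    (Complex.Gamma (-(2 * δ * I)) * Complex.Gamma (1 - 2 * δ * I) /
      Complex.Gamma (1 / 2 - δ * I - m * I) ^ 2) *
    (Complex.Gamma (1 - 2 * ωh * I) / Complex.Gamma (1 / 2 - δ * I + m * I - 2 * ωh * I))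

/-! ### Gamma moduli on the lines `re = 1/2`, `re = 0`, `re = 1` -/

/-- `|Γ(iy)|² = π / (y sinh(πy))` for real `y ≠ 0`. [cite: DLMF, 5.4.3] -/
theorem normSq_Gamma_mul_I {y : ℝ} (hy : y ≠ 0) :
    ‖Complex.Gamma (y * I)‖ ^ 2 = π / (y * Real.sinh (π * y)) := by
  have h1 := Literature.Analysis.SpecialFunctions.GammaVert.norm_sq_Gamma_one y hy
  have hw : (y : ℂ) * I ≠ 0 := mul_ne_zero (by exact_mod_cast hy) I_ne_zero
  have hrec : Complex.Gamma (1 + y * I) = y * I * Complex.Gamma (y * I) := by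
    rw [add_comm]; exact Complex.Gamma_add_one _ hw
  have hn : ‖Complex.Gamma (1 + y * I)‖ = |y| * ‖Complex.Gamma (y * I)‖ := by
    rw [hrec, norm_mul, norm_mul, Complex.norm_I, mul_one, Complex.norm_real, Real.norm_eq_abs]
  have hsinh : y * Real.sinh (π * y) ≠ 0 := by
    refine mul_ne_zero hy (Real.sinh_ne_zero.mpr (mul_ne_zero Real.pi_pos.ne' hy))
  have hy2 : (0 : ℝ) < y ^ 2 := by positivity
  rw [hn, mul_pow, sq_abs] at h1
  field_simp at h1 ⊢
  nlinarith [h1]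

/-- `|Γ(1 − iy)|² = πy / sinh(πy)` for real `y ≠ 0` (even in `y`). [cite: DLMF, 5.4.3] -/
theorem normSq_Gamma_one_sub {y : ℝ} (hy : y ≠ 0) :
    ‖Complex.Gamma (1 - y * I)‖ ^ 2 = π * y / Real.sinh (π * y) := by
  have h := Literature.Analysis.SpecialFunctions.GammaVert.norm_sq_Gamma_one (-y) (neg_ne_zero.mpr hy)
  rw [show (1 : ℂ) + ((-y : ℝ) : ℂ) * I = 1 - y * I by push_cast; ring] at h
  rw [h, show π * -y = -(π * y) by ring, Real.sinh_neg]
  ring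

/-- `|(−im)^w| = m^{Re w} · e^{(π/2) Im w}` for `m > 0` (`arg(−im) = −π/2`). [folklore] -/
theorem norm_negImul_cpow {m : ℝ} (hm : 0 < m) (w : ℂ) :
    ‖(-(I * m)) ^ w‖ = m ^ w.re * Real.exp (π / 2 * w.im) := by
  have hz : -(I * (m : ℂ)) ≠ 0 := by
    simp [hm.ne']
  rw [Complex.norm_cpow_of_ne_zero hz]
  have hnorm : ‖-(I * (m : ℂ))‖ = m := by
    rw [norm_neg, norm_mul, Complex.norm_I, one_mul, Complex.norm_real, Real.norm_eq_abs, abs_of_pos hm]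
  have harg : Complex.arg (-(I * (m : ℂ))) = -(π / 2) := by
    rw [show -(I * (m : ℂ)) = (m : ℂ) * (-I) by ring, Complex.arg_real_mul _ hm, Complex.arg_neg_I]
  rw [hnorm, harg, div_eq_mul_inv, ← Real.exp_neg]
  congr 1
  ring_nf

/-! ### The closed form of `‖C_δ‖²` -/

/-- **Squared modulus of the Teukolsky–Press coefficient** (`m > 0`, `δ ≠ 0`):
`‖C_δ‖² = e^{π(δ−m)} cosh²(π(m+δ)) cosh(π(2ω̂−m+δ)) ‖Γ(1−2iω̂)‖² / (π m sinh²(2πδ))`.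
[cite: GrallaZimmermanZimmerman2016, Section 2.2 eq. (Zin)] -/
theorem normSq_tpCoeff {m δ : ℝ} (hm : 0 < m) (hδ : δ ≠ 0) (ωh : ℝ) :
    ‖tpCoeff m δ ωh‖ ^ 2 =
      Real.exp (π * (δ - m)) * Real.cosh (π * (m + δ)) ^ 2 * Real.cosh (π * (2 * ωh - m + δ)) *
        ‖Complex.Gamma (1 - 2 * ωh * I)‖ ^ 2 / (π * m * Real.sinh (2 * π * δ) ^ 2) := by
  -- the four moduli
  have hpow : ‖(-(I * (m : ℂ))) ^ (-(1 / 2 : ℂ) + δ * I - m * I)‖ ^ 2 = m⁻¹ * Real.exp (π * (δ - m)) := by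
    rw [norm_negImul_cpow hm]
    have hre : (-(1 / 2 : ℂ) + δ * I - m * I).re = -(1 / 2) := by simp
    have him : (-(1 / 2 : ℂ) + δ * I - m * I).im = δ - m := by simp
    rw [hre, him, mul_pow, ← Real.exp_nat_mul]
    have hm2 : (m ^ (-(1 / 2 : ℝ))) ^ 2 = m⁻¹ := by
      rw [← Real.rpow_natCast, ← Real.rpow_mul hm.le]
      norm_num
      rw [Real.rpow_neg_one]
    rw [hm2]
    congr 1
    push_cast
    ring
  have h2δ : (2 * δ : ℝ) ≠ 0 := by positivity
  have hG0 : ‖Complex.Gamma (-(2 * δ * I))‖ ^ 2 = π / (2 * δ * Real.sinh (2 * π * δ)) := by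
    have h := normSq_Gamma_mul_I (y := -(2 * δ)) (neg_ne_zero.mpr h2δ)
    rw [show (((-(2 * δ) : ℝ) : ℂ)) * I = -(2 * δ * I) by push_cast; ring] at h
    rw [h, show π * -(2 * δ) = -(2 * π * δ) by ring, Real.sinh_neg]
    ring
  have hG1 : ‖Complex.Gamma (1 - 2 * δ * I)‖ ^ 2 = 2 * π * δ / Real.sinh (2 * π * δ) := by
    have h := normSq_Gamma_one_sub (y := 2 * δ) h2δ
    rw [show (((2 * δ : ℝ)) : ℂ) * I = 2 * δ * I by push_cast; ring] at h
    rw [h]; ring_nf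
  have hGa : ‖Complex.Gamma (1 / 2 - δ * I - m * I)‖ ^ 2 = π / Real.cosh (π * (m + δ)) := by
    have h := Literature.NumberTheory.LFunctions.AFE.norm_Gamma_half_sub_sq (δ + m)
    rw [show (1 / 2 : ℂ) - ((δ + m : ℝ) : ℂ) * I = 1 / 2 - δ * I - m * I by push_cast; ring] at h
    rw [h, show π * (δ + m) = π * (m + δ) by ring]
  have hGb : ‖Complex.Gamma (1 / 2 - δ * I + m * I - 2 * ωh * I)‖ ^ 2 = π / Real.cosh (π * (2 * ωh - m + δ)) := by
    have h := Literature.NumberTheory.LFunctions.AFE.norm_Gamma_half_sub_sq (δ - m + 2 * ωh)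
    rw [show (1 / 2 : ℂ) - ((δ - m + 2 * ωh : ℝ) : ℂ) * I = 1 / 2 - δ * I + m * I - 2 * ωh * I by
      push_cast; ring] at h
    rw [h, show π * (δ - m + 2 * ωh) = π * (2 * ωh - m + δ) by ring]
  -- positivity facts
  have hc1 : 0 < Real.cosh (π * (m + δ)) := Real.cosh_pos _
  have hc2 : 0 < Real.cosh (π * (2 * ωh - m + δ)) := Real.cosh_pos _
  have hs : Real.sinh (2 * π * δ) ≠ 0 := Real.sinh_ne_zero.mpr (by positivity)
  -- assemble
  unfold tpCoeff
  rw [norm_mul, norm_mul, norm_div, norm_div, norm_mul, norm_pow, mul_pow, mul_pow, div_pow, div_pow,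
    mul_pow, hpow, hG0, hG1, hGb]
  rw [show (‖Complex.Gamma (1 / 2 - ↑δ * I - ↑m * I)‖ ^ 2) ^ 2 = (π / Real.cosh (π * (m + δ))) ^ 2 by
    rw [← hGa]]
  field_simp

/-! ### Dominance of the principal term, uniformly in the frequency `ω̂` -/

/-- `cosh(y − c) ≤ e^{2c} cosh(y + c)` for `c ≥ 0` (the supremum `e^{2c}` of the ratio is approached as
`y → −∞`). [folklore] -/
theorem cosh_sub_le_exp_mul_cosh_add (y : ℝ) {c : ℝ} (hc : 0 ≤ c) :
    Real.cosh (y - c) ≤ Real.exp (2 * c) * Real.cosh (y + c) := by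
  rw [Real.cosh_eq, Real.cosh_eq]
  have e1 : Real.exp (2 * c) * Real.exp (y + c) = Real.exp (y - c) * Real.exp (4 * c) := by
    rw [← Real.exp_add, ← Real.exp_add]; ring_nf
  have e2 : Real.exp (2 * c) * Real.exp (-(y + c)) = Real.exp (-(y - c)) := by
    rw [← Real.exp_add]; ring_nf
  have h4 : 1 ≤ Real.exp (4 * c) := Real.one_le_exp (by linarith)
  have hpos : 0 < Real.exp (y - c) := Real.exp_pos _
  nlinarith [mul_le_mul_of_nonneg_left h4 hpos.le, Real.exp_pos (-(y - c))]

/-- **The principal term dominates, uniformly in `ω̂`** (`m > 0`, `δ > 0`):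
`‖C_{−δ}‖² · cosh²(π(m+δ)) ≤ ‖C_δ‖² · cosh²(π(m−δ))`. Proof: by `normSq_tpCoeff` the ratio
`‖C_{−δ}‖²/‖C_δ‖²` equals `e^{−2πδ} · cosh²π(m−δ)/cosh²π(m+δ) · cosh π(2ω̂−m−δ)/cosh π(2ω̂−m+δ)` and
`cosh π(2ω̂−m−δ) ≤ e^{2πδ} cosh π(2ω̂−m+δ)`. [cite: GrallaZimmermanZimmerman2016, Section 2.2 eq. (Zin)] -/
theorem normSq_tpCoeff_neg_mul_le {m δ : ℝ} (hm : 0 < m) (hδ : 0 < δ) (ωh : ℝ) :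
    ‖tpCoeff m (-δ) ωh‖ ^ 2 * Real.cosh (π * (m + δ)) ^ 2 ≤
      ‖tpCoeff m δ ωh‖ ^ 2 * Real.cosh (π * (m - δ)) ^ 2 := by
  rw [normSq_tpCoeff hm (neg_ne_zero.mpr hδ.ne') ωh, normSq_tpCoeff hm hδ.ne' ωh]
  have hsinh : Real.sinh (2 * π * -δ) ^ 2 = Real.sinh (2 * π * δ) ^ 2 := by
    rw [show 2 * π * -δ = -(2 * π * δ) by ring, Real.sinh_neg, neg_sq]
  rw [hsinh, show π * (m + -δ) = π * (m - δ) by ring]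
  set G := ‖Complex.Gamma (1 - 2 * ωh * I)‖ ^ 2 with hG
  set S := Real.sinh (2 * π * δ) ^ 2 with hS
  have hSpos : 0 < S := by
    have : Real.sinh (2 * π * δ) ≠ 0 := Real.sinh_ne_zero.mpr (by positivity)
    positivity
  have hGnn : 0 ≤ G := by positivity
  have hden : 0 < π * m * S := by positivity
  -- the key one-line inequality, with c = πδ, y = π(2ω̂ − m)
  have hkey : Real.cosh (π * (2 * ωh - m + -δ)) ≤ Real.exp (2 * (π * δ)) * Real.cosh (π * (2 * ωh - m + δ)) := by
    have h := cosh_sub_le_exp_mul_cosh_add (π * (2 * ωh - m)) (c := π * δ) (by positivity)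
    convert h using 2 <;> ring_nf
  have hexp : Real.exp (π * (-δ - m)) * Real.exp (2 * (π * δ)) = Real.exp (π * (δ - m)) := by
    rw [← Real.exp_add]; ring_nf
  rw [div_mul_eq_mul_div, div_mul_eq_mul_div, div_le_div_iff_of_pos_right hden]
  have hA : 0 ≤ Real.exp (π * (-δ - m)) * Real.cosh (π * (m - δ)) ^ 2 * G * Real.cosh (π * (m + δ)) ^ 2 := by
    positivity
  calc Real.exp (π * (-δ - m)) * Real.cosh (π * (m - δ)) ^ 2 * Real.cosh (π * (2 * ωh - m + -δ)) * G *
        Real.cosh (π * (m + δ)) ^ 2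
      = (Real.exp (π * (-δ - m)) * Real.cosh (π * (m - δ)) ^ 2 * G * Real.cosh (π * (m + δ)) ^ 2) *
          Real.cosh (π * (2 * ωh - m + -δ)) := by ring
    _ ≤ (Real.exp (π * (-δ - m)) * Real.cosh (π * (m - δ)) ^ 2 * G * Real.cosh (π * (m + δ)) ^ 2) *
          (Real.exp (2 * (π * δ)) * Real.cosh (π * (2 * ωh - m + δ))) :=
        mul_le_mul_of_nonneg_left hkey hA
    _ = Real.exp (π * (δ - m)) * Real.cosh (π * (m + δ)) ^ 2 * Real.cosh (π * (2 * ωh - m + δ)) * G *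
          Real.cosh (π * (m - δ)) ^ 2 := by rw [← hexp]; ring

/-- `cosh(π(m−δ)) < cosh(π(m+δ))` for `m, δ > 0`. [folklore] -/
theorem cosh_sub_lt_cosh_add {m δ : ℝ} (hm : 0 < m) (hδ : 0 < δ) :
    Real.cosh (π * (m - δ)) < Real.cosh (π * (m + δ)) := by
  rw [Real.cosh_lt_cosh, abs_of_pos (by positivity : 0 < π * (m + δ)), abs_lt]
  constructor <;> nlinarith [Real.pi_pos, mul_pos Real.pi_pos hm, mul_pos Real.pi_pos hδ]

/-- **Corollary: strict dominance** `‖C_{−δ}‖ < ‖C_δ‖` for every `ω̂` (`m, δ > 0`) — the two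
Teukolsky–Press terms never have equal modulus, so the leading-order near-extremal incident amplitude
`C_δ σ^{½+iδ} + C_{−δ} σ^{½−iδ}` cannot cancel. [cite: GrallaZimmermanZimmerman2016, Section 2.2 eq. (Zin)] -/
theorem norm_tpCoeff_neg_lt {m δ : ℝ} (hm : 0 < m) (hδ : 0 < δ) (ωh : ℝ) :
    ‖tpCoeff m (-δ) ωh‖ < ‖tpCoeff m δ ωh‖ := by
  have h := normSq_tpCoeff_neg_mul_le hm hδ ωh
  have hlt := cosh_sub_lt_cosh_add hm hδ
  have hcpos : 0 < Real.cosh (π * (m - δ)) := Real.cosh_pos _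
  -- ‖C_δ‖ ≠ 0 : from the closed form (all factors positive)
  have hpos : 0 < ‖tpCoeff m δ ωh‖ ^ 2 := by
    rw [normSq_tpCoeff hm hδ.ne' ωh]
    have hs : Real.sinh (2 * π * δ) ≠ 0 := Real.sinh_ne_zero.mpr (by positivity)
    have hG : 0 < ‖Complex.Gamma (1 - 2 * ωh * I)‖ ^ 2 := by
      have : Complex.Gamma (1 - 2 * ωh * I) ≠ 0 := Complex.Gamma_ne_zero_of_re_pos (by simp)
      positivity
    have hc1 : 0 < Real.cosh (π * (m + δ)) := Real.cosh_pos _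
    have hc2 : 0 < Real.cosh (π * (2 * ωh - m + δ)) := Real.cosh_pos _
    positivity
  by_contra hge
  push Not at hge
  have h1 : ‖tpCoeff m δ ωh‖ ^ 2 ≤ ‖tpCoeff m (-δ) ωh‖ ^ 2 := pow_le_pow_left₀ (norm_nonneg _) hge 2
  have h2 : ‖tpCoeff m δ ωh‖ ^ 2 * Real.cosh (π * (m - δ)) ^ 2 <
      ‖tpCoeff m δ ωh‖ ^ 2 * Real.cosh (π * (m + δ)) ^ 2 := by
    apply mul_lt_mul_of_pos_left _ hpos
    exact pow_lt_pow_left₀ hlt hcpos.le two_ne_zero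
  have h3 : ‖tpCoeff m δ ωh‖ ^ 2 * Real.cosh (π * (m + δ)) ^ 2 ≤
      ‖tpCoeff m (-δ) ωh‖ ^ 2 * Real.cosh (π * (m + δ)) ^ 2 :=
    mul_le_mul_of_nonneg_right h1 (by positivity)
  linarith

/-- **No cancellation, quantitatively**: for any unimodular phase `u` (in the application `u = σ^{−2iδ}`),
`‖C_δ + C_{−δ} u‖ ≥ ‖C_δ‖ · (1 − cosh π(m−δ)/cosh π(m+δ))`, the explicit lower bound behind
`|𝒲|² = 4ω²σ‖C_δ + C_{−δ}σ^{−2iδ}‖² ≳ σ`. [cite: GrallaZimmermanZimmerman2016, Section 2.2 eq. (Zin)] -/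
theorem norm_twoTerm_ge {m δ : ℝ} (hm : 0 < m) (hδ : 0 < δ) (ωh : ℝ) {u : ℂ} (hu : ‖u‖ = 1) :
    ‖tpCoeff m δ ωh‖ * (1 - Real.cosh (π * (m - δ)) / Real.cosh (π * (m + δ))) ≤
      ‖tpCoeff m δ ωh + tpCoeff m (-δ) ωh * u‖ := by
  have hcp : 0 < Real.cosh (π * (m + δ)) := Real.cosh_pos _
  have hcm : 0 < Real.cosh (π * (m - δ)) := Real.cosh_pos _
  -- ‖C_{-δ}‖ ≤ ‖C_δ‖ · cosh π(m−δ)/cosh π(m+δ)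
  have hratio : ‖tpCoeff m (-δ) ωh‖ ≤ ‖tpCoeff m δ ωh‖ * (Real.cosh (π * (m - δ)) / Real.cosh (π * (m + δ))) := by
    have h := normSq_tpCoeff_neg_mul_le hm hδ ωh
    have h' : (‖tpCoeff m (-δ) ωh‖ * Real.cosh (π * (m + δ))) ^ 2 ≤
        (‖tpCoeff m δ ωh‖ * Real.cosh (π * (m - δ))) ^ 2 := by
      rw [mul_pow, mul_pow]; exact h
    have h'' := (pow_le_pow_iff_left₀ (by positivity) (by positivity) two_ne_zero).1 h'
    rw [mul_div_assoc', le_div_iff₀ hcp]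
    exact h''
  calc ‖tpCoeff m δ ωh‖ * (1 - Real.cosh (π * (m - δ)) / Real.cosh (π * (m + δ)))
      = ‖tpCoeff m δ ωh‖ - ‖tpCoeff m δ ωh‖ * (Real.cosh (π * (m - δ)) / Real.cosh (π * (m + δ))) := by ring
    _ ≤ ‖tpCoeff m δ ωh‖ - ‖tpCoeff m (-δ) ωh * u‖ := by
        rw [norm_mul, hu, mul_one]; linarith
    _ ≤ ‖tpCoeff m δ ωh + tpCoeff m (-δ) ωh * u‖ := by
        have h1 : ‖tpCoeff m δ ωh‖ ≤ ‖tpCoeff m δ ωh + tpCoeff m (-δ) ωh * u‖ + ‖tpCoeff m (-δ) ωh * u‖ := by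
          simpa using norm_add_le (tpCoeff m δ ωh + tpCoeff m (-δ) ωh * u) (-(tpCoeff m (-δ) ωh * u))
        linarith

end Literature.Geometry.Lorentzian.Kerr.TeukolskyPress

end
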